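import Mathlib
import Summits.Ventures.PercRepro2.HCov
import Summits.Ventures.PercRepro2.GcSkelReductionT
import Summits.Ventures.PercRepro2.GcSkelReductionMin
import Summits.Ventures.PercRepro2.GcSkelReductionO
import Summits.Ventures.PercRepro2.GcSkelReductionOB
import Summits.Ventures.PercRepro2.GcSkelReductionMinOB
import Summits.Ventures.PercRepro2.GcSkelReductionH

/-!
# The class of record with its minimal clause list, pole hub included (blind cell PercRepro2,
typer-1 g54)

`WReducedH` (`GcSkelReductionH.lean`) is `WReducedOB` minus the pole hub; `WReducedMinOB`
(`GcSkelReductionMinOB.lean`) is the one-definition form of `WReducedOB`. Together: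

* **`WReducedMinH`** := `WReducedMinOB` ∧ ¬ pole hub — the class of record in ONE definition of
  twenty-seven finite clauses;
* **`wredH_iff_wredMinH`**: `WReducedH ↔ WReducedMinH`; **`HCov_all_iff_HCovWRedMinH_all`**.
-/

namespace Summit.Ventures.PercRepro2

open CovForm RECM

namespace WRed

section ClassMinH

variable {V : Type*} {E : Type*} [Fintype E] [DecidableEq E] [DecidableEq V]

/-- **The class of record with its minimal clause list, pole hub included**: `WReducedMinOB` and
the pole-hub clause. -/
structure WReducedMinH (ends : E → Sym2 V) (o a₁ a₂ a₃ b : V) : Prop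
    extends WReducedMinOB ends o a₁ a₂ a₃ b where
  /-- not the pole-hub class -/
  notPoleHub : ¬ PoleHubToMarks ends o a₁ a₂ a₃ b

/-- **The class of record is its minimal clause list**: `WReducedH ↔ WReducedMinH`. -/
theorem wredH_iff_wredMinH {ends : E → Sym2 V} {o a₁ a₂ a₃ b : V} :
    WReducedH ends o a₁ a₂ a₃ b ↔ WReducedMinH ends o a₁ a₂ a₃ b :=
  ⟨fun h => ⟨wredOB_iff_wredMinOB.1 h.toWReducedOB, h.notPoleHub⟩,
   fun h => ⟨wredOB_iff_wredMinOB.2 h.toWReducedMinOB, h.notPoleHub⟩⟩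

end ClassMinH

section Closure

variable (R : Type*) [Field R] [LinearOrder R] [IsStrictOrderedRing R]

/-- **(HCOV) on the class of record, minimal clause list, pole hub included**. -/
def HCovWRedMinH_all : Prop :=
  ∀ (V E : Type) [Fintype V] [DecidableEq V] [Fintype E] [DecidableEq E]
    (ends : E → Sym2 V) (p : E → R), IsProbVec p →
    ∀ o a₁ a₂ a₃ b : V, a₁ ≠ a₂ → a₁ ≠ a₃ → a₂ ≠ a₃ → o ≠ a₁ → o ≠ a₂ → o ≠ a₃ → o ≠ b →
      b ≠ a₁ → b ≠ a₂ → b ≠ a₃ → WReducedMinH ends o a₁ a₂ a₃ b → HCov p ends o a₁ a₂ a₃ b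

end Closure

section Main

variable {R : Type*} [Field R] [LinearOrder R] [IsStrictOrderedRing R]

omit [IsStrictOrderedRing R] in
/-- The two closures agree clause for clause. -/
theorem HCovWRedH_all_iff_HCovWRedMinH_all : HCovWRedH_all R ↔ HCovWRedMinH_all R := by
  constructor
  · intro h V E _ _ _ _ ends p hp o a₁ a₂ a₃ b h12 h13 h23 ho1 ho2 ho3 hob hb1 hb2 hb3 hred
    exact h V E ends p hp o a₁ a₂ a₃ b h12 h13 h23 ho1 ho2 ho3 hob hb1 hb2 hb3
      (wredH_iff_wredMinH.2 hred)
  · intro h V E _ _ _ _ ends p hp o a₁ a₂ a₃ b h12 h13 h23 ho1 ho2 ho3 hob hb1 hb2 hb3 hred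
    exact h V E ends p hp o a₁ a₂ a₃ b h12 h13 h23 ho1 ho2 ho3 hob hb1 hb2 hb3
      (wredH_iff_wredMinH.1 hred)

/-- **THE CRUX ON THE CLASS OF RECORD, MINIMAL CLAUSE LIST, POLE HUB INCLUDED**:
`HCov_all ↔ HCovWRedMinH_all`. -/
theorem HCov_all_iff_HCovWRedMinH_all : HCov_all R ↔ HCovWRedMinH_all R :=
  HCov_all_iff_HCovWRedH_all.trans HCovWRedH_all_iff_HCovWRedMinH_all

end Main

end WRed

end Summit.Ventures.PercRepro2
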